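import Summits.Ventures.HodgeRepro2.T5SU11ResolventBoundary

/-!
# The bracket `sinh 2t · χ_λ χ_λ′` vanishes at infinity

For the energy identity of the resolvent (next row) the boundary term at infinity is `sinh 2R · u(R) u′(R)` with
`u = −c₂ χ_λ` on `[b, ∞)`, i.e. a multiple of `sinh 2R · χ_λ(R) χ_λ′(R)`. With `χ_λ = φ_λ T_λ`
(`T_λ(t) = ∫_t^∞ ds/(sinh 2s φ_λ²)`, row 448) and `χ_λ′ = φ_λ′ T_λ − 1/(sinh 2t φ_λ)` (row 468),

  **`sinh 2t χ_λ χ_λ′ = (sinh 2t φ_λ′) φ_λ T_λ² − T_λ = λ(λ−2) · χ_λ T_λ ∫_0^t sinh 2s φ_λ − T_λ`**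
  (`sinh_mul_sphDecay_mul_sphDecay'`),

where the divergence form of the radial equation integrated from `0` gives **`sinh 2t φ_λ′(t) = λ(λ−2)
∫_0^t sinh 2s φ_λ(a_s) ds`** (`sinh_mul_deriv_sph_hyp_eq`, row 338's Lagrange identity against `φ_0 ≡ 1`). The
eventual bounds `χ_λ ≤ 2L e^{−λt}` (`eventually_sphDecay_le`, row 450), `T_λ ≤ 2K e^{−2(λ−1)t}` (row 468) and
`∫_0^R sinh 2s φ_λ ≤ C₀ + R c e^{λR}` (`exists_eventually_integral_sinh_sph_le`) give
`χ_λ T_λ ∫_0^R sinh 2s φ_λ = O(e^{−(3λ−2)R}) + O(R e^{−(2λ−2)R}) → 0` (`tendsto_sphDecay_mul_tailIntegral_mul_integral`),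
hence **`sinh 2R · χ_λ(R) χ_λ′(R) → 0`** for every `λ > 1` (`tendsto_sinh_mul_sphDecay_mul_sphDecay'`) — the
exact rate being `e^{(2−2λ)R}`. Nothing is claimed about (N).

Blind lane: Mathlib + the HodgeRepro2 prefix only; no sorry; axioms ⊆ {propext, Classical.choice,
Quot.sound}.
-/

namespace Summit.Ventures.HodgeRepro2.T5SU11SphericalDecayBracket

open Filter Topology MeasureTheory intervalIntegral
open Set (Ioi Ioc)
open T5SU11Cartan T5SU11SphericalFunction T5SU11SphericalBounds T5SU11SphericalSymmetry T5SU11SphericalContinuous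
  T5SU11SphericalAsymptotic T5SU11SphericalCfun T5SU11SphericalUnique T5SU11ReductionOfOrder
  T5SU11ReductionOfOrderInfinity T5SU11SphericalSolutionSpaceAll T5SU11SphericalDecay
  T5SU11SphericalDecayAsymptotic T5SU11ResolventBoundary

section measure

variable [MeasurableSpace Circle] [BorelSpace Circle]

/-! ### The divergence form integrated from `0` -/

/-- **`sinh 2R · φ_λ′(R) = λ(λ−2) ∫_0^R sinh 2t φ_λ(a_t) dt`** (row 338's Lagrange identity against `φ_0 ≡ 1`). -/
theorem sinh_mul_deriv_sph_hyp_eq (lam R : ℝ) :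
    Real.sinh (2 * R) * deriv (fun t => sph lam (hyp t)) R
      = lam * (lam - 2) * ∫ t in (0 : ℝ)..R, Real.sinh (2 * t) * sph lam (hyp t) := by
  have h := lagrange_identity lam 0 R
  simp only [sph_zero, mul_one, deriv_const, mul_zero, sub_zero, zero_mul] at h
  exact h.symm

/-! ### The ingredients -/

omit [BorelSpace Circle] in
/-- `χ_λ = φ_λ T_λ`. -/
theorem sphDecay_eq (lam t : ℝ) :
    sphDecay lam t = sph lam (hyp t) * tailIntegral (fun t => sph lam (hyp t)) t := rfl

/-- `T_λ ≥ 0` on `(0, ∞)`. -/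
theorem tailIntegral_sph_nonneg {lam : ℝ} (hlam : 1 < lam) {t : ℝ} (ht : 0 < t) :
    0 ≤ tailIntegral (fun t => sph lam (hyp t)) t :=
  (tailIntegral_pos (hφ_sph lam) (hpos_sph lam) (integrableOn_roIntegrand_sph hlam) ht).le

/-- `T_λ(R) → 0`. -/
theorem tendsto_tailIntegral_sph_atTop {lam : ℝ} (hlam : 1 < lam) :
    Tendsto (tailIntegral (fun t => sph lam (hyp t))) atTop (𝓝 0) :=
  tendsto_tailIntegral_atTop (hφ_sph lam) (hpos_sph lam) (integrableOn_roIntegrand_sph hlam)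

/-- The eventual bound **`χ_λ(t) ≤ 2L e^{−λt}`**, `L = 1/((λ−1)c(2−λ))` (row 450's exact rate). -/
theorem eventually_sphDecay_le {lam : ℝ} (hlam : 1 < lam) :
    ∀ᶠ t in atTop, sphDecay lam t ≤ 2 * (1 / ((lam - 1) * cfun (2 - lam))) * Real.exp (-lam * t) := by
  have h := (tendsto_exp_mul_sphDecay hlam).eventually (eventually_le_nhds
    (by linarith [sphDecay_limit_pos hlam] :
      1 / ((lam - 1) * cfun (2 - lam)) < 2 * (1 / ((lam - 1) * cfun (2 - lam)))))
  filter_upwards [h] with t ht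
  have hE : 0 < Real.exp (-lam * t) := Real.exp_pos _
  calc sphDecay lam t = Real.exp (-lam * t) * (Real.exp (lam * t) * sphDecay lam t) := by
        rw [← mul_assoc, ← Real.exp_add, show -lam * t + lam * t = 0 by ring, Real.exp_zero, one_mul]
    _ ≤ Real.exp (-lam * t) * (2 * (1 / ((lam - 1) * cfun (2 - lam)))) := mul_le_mul_of_nonneg_left ht hE.le
    _ = 2 * (1 / ((lam - 1) * cfun (2 - lam))) * Real.exp (-lam * t) := by ring

/-- `sinh 2t φ_λ ≥ 0` for `t ≥ 0`. -/
theorem sinh_mul_sph_hyp_nonneg (lam : ℝ) {t : ℝ} (ht : 0 ≤ t) : 0 ≤ Real.sinh (2 * t) * sph lam (hyp t) :=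
  mul_nonneg (Real.sinh_nonneg_iff.mpr (by linarith)) (sph_hyp_pos lam t).le

/-- The eventual bound **`∫_0^R sinh 2t φ_λ ≤ C₀ + R · c(2−λ) e^{λR}`**. -/
theorem exists_eventually_integral_sinh_sph_le {lam : ℝ} (hlam : 1 < lam) :
    ∃ C₀ : ℝ, 0 ≤ C₀ ∧ ∀ᶠ R in atTop, ∫ t in (0 : ℝ)..R, Real.sinh (2 * t) * sph lam (hyp t)
      ≤ C₀ + R * (cfun (2 - lam) * Real.exp (lam * R)) := by
  have hc : 0 < cfun (2 - lam) := cfun_pos (by linarith)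
  obtain ⟨T₀, hT₀⟩ := eventually_atTop.mp (eventually_sph_hyp_le hlam)
  set M := max T₀ 0 with hM
  have hcont : Continuous fun t => Real.sinh (2 * t) * sph lam (hyp t) :=
    (Real.continuous_sinh.comp (continuous_const.mul continuous_id)).mul (continuous_sph_hyp lam)
  refine ⟨∫ t in (0 : ℝ)..M, Real.sinh (2 * t) * sph lam (hyp t),
    integral_nonneg (le_max_right _ _) (fun t ht => sinh_mul_sph_hyp_nonneg lam ht.1), ?_⟩
  filter_upwards [eventually_ge_atTop M] with R hR
  rw [← integral_add_adjacent_intervals (hcont.intervalIntegrable _ _) (hcont.intervalIntegrable _ _)]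
  have htail_nn : 0 ≤ ∫ t in M..R, Real.sinh (2 * t) * sph lam (hyp t) :=
    integral_nonneg hR (fun t ht => sinh_mul_sph_hyp_nonneg lam (le_trans (le_max_right _ _) ht.1))
  have hM' : ∀ t ∈ Set.uIoc M R, ‖Real.sinh (2 * t) * sph lam (hyp t)‖
      ≤ cfun (2 - lam) * Real.exp (lam * R) := by
    intro t ht
    rw [Set.uIoc_of_le hR] at ht
    have ht0 : 0 ≤ t := le_trans (le_max_right _ _) ht.1.le
    have htT : T₀ ≤ t := le_trans (le_max_left _ _) ht.1.le
    have hb1 := hT₀ t htT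
    have hs : Real.sinh (2 * t) ≤ Real.exp (2 * t) / 2 := sinh_le_exp_div_two _
    rw [Real.norm_eq_abs, abs_of_nonneg (sinh_mul_sph_hyp_nonneg lam ht0)]
    have hexp : Real.exp (lam * t) ≤ Real.exp (lam * R) :=
      Real.exp_le_exp.mpr (mul_le_mul_of_nonneg_left ht.2 (by linarith))
    calc Real.sinh (2 * t) * sph lam (hyp t)
        ≤ (Real.exp (2 * t) / 2) * (2 * cfun (2 - lam) * Real.exp ((lam - 2) * t)) :=
          mul_le_mul hs hb1 (sph_hyp_pos lam t).le (by positivity)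
      _ = cfun (2 - lam) * Real.exp (lam * t) := by
          rw [show Real.exp (lam * t) = Real.exp (2 * t) * Real.exp ((lam - 2) * t) by
            rw [← Real.exp_add]; congr 1; ring]
          ring
      _ ≤ cfun (2 - lam) * Real.exp (lam * R) := mul_le_mul_of_nonneg_left hexp hc.le
  have hnorm := norm_integral_le_of_norm_le_const hM'
  rw [Real.norm_eq_abs, abs_of_nonneg htail_nn] at hnorm
  have habs : |R - M| ≤ R := by
    rw [abs_of_nonneg (by linarith)]
    linarith [le_max_right T₀ 0]
  have hcR : 0 ≤ cfun (2 - lam) * Real.exp (lam * R) := by positivity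
  have : ∫ t in M..R, Real.sinh (2 * t) * sph lam (hyp t) ≤ R * (cfun (2 - lam) * Real.exp (lam * R)) := by
    calc ∫ t in M..R, Real.sinh (2 * t) * sph lam (hyp t)
        ≤ cfun (2 - lam) * Real.exp (lam * R) * |R - M| := hnorm
      _ ≤ cfun (2 - lam) * Real.exp (lam * R) * R := mul_le_mul_of_nonneg_left habs hcR
      _ = R * (cfun (2 - lam) * Real.exp (lam * R)) := by ring
  linarith

/-! ### `χ_λ T_λ ∫_0^R sinh 2t φ_λ → 0` -/

/-- **`χ_λ(R) · T_λ(R) · ∫_0^R sinh 2t φ_λ(a_t) dt → 0`** for `λ > 1`. -/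
theorem tendsto_sphDecay_mul_tailIntegral_mul_integral {lam : ℝ} (hlam : 1 < lam) :
    Tendsto (fun R => sphDecay lam R * (tailIntegral (fun t => sph lam (hyp t)) R
      * ∫ t in (0 : ℝ)..R, Real.sinh (2 * t) * sph lam (hyp t))) atTop (𝓝 0) := by
  have hc : 0 < cfun (2 - lam) := cfun_pos (by linarith)
  set L := 1 / ((lam - 1) * cfun (2 - lam)) with hL
  set K := 1 / ((lam - 1) * cfun (2 - lam) ^ 2) with hK
  have hLpos : 0 < L := sphDecay_limit_pos hlam
  have hKpos : 0 < K := by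
    have : 0 < lam - 1 := by linarith
    positivity
  obtain ⟨C₀, hC₀, hint⟩ := exists_eventually_integral_sinh_sph_le hlam
  have hbound : ∀ᶠ R in atTop, sphDecay lam R * (tailIntegral (fun t => sph lam (hyp t)) R
        * ∫ t in (0 : ℝ)..R, Real.sinh (2 * t) * sph lam (hyp t))
      ≤ 4 * L * K * C₀ * Real.exp (-(3 * lam - 2) * R)
        + 4 * L * K * cfun (2 - lam) * (R * Real.exp (-(2 * lam - 2) * R)) := by
    filter_upwards [eventually_sphDecay_le hlam, eventually_tailIntegral_le hlam, hint, eventually_gt_atTop 0]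
      with R h1 h2 h3 hR0
    have hT0 : 0 ≤ tailIntegral (fun t => sph lam (hyp t)) R := tailIntegral_sph_nonneg hlam hR0
    have hI0 : 0 ≤ ∫ t in (0 : ℝ)..R, Real.sinh (2 * t) * sph lam (hyp t) :=
      integral_nonneg hR0.le (fun t ht => sinh_mul_sph_hyp_nonneg lam ht.1)
    calc sphDecay lam R * (tailIntegral (fun t => sph lam (hyp t)) R
          * ∫ t in (0 : ℝ)..R, Real.sinh (2 * t) * sph lam (hyp t))
        ≤ (2 * L * Real.exp (-lam * R)) * ((2 * K * Real.exp (-(2 * (lam - 1)) * R))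
            * (C₀ + R * (cfun (2 - lam) * Real.exp (lam * R)))) :=
          mul_le_mul h1 (mul_le_mul h2 h3 hI0 (by positivity)) (mul_nonneg hT0 hI0) (by positivity)
      _ = 4 * L * K * C₀ * Real.exp (-(3 * lam - 2) * R)
          + 4 * L * K * cfun (2 - lam) * (R * Real.exp (-(2 * lam - 2) * R)) := by
          rw [show Real.exp (-(3 * lam - 2) * R) = Real.exp (-lam * R) * Real.exp (-(2 * (lam - 1)) * R) by
              rw [← Real.exp_add]; congr 1; ring,
            show Real.exp (-(2 * lam - 2) * R)
                = Real.exp (-lam * R) * Real.exp (-(2 * (lam - 1)) * R) * Real.exp (lam * R) by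
              rw [← Real.exp_add, ← Real.exp_add]; congr 1; ring]
          ring
  have hlower : ∀ᶠ R in atTop, 0 ≤ sphDecay lam R * (tailIntegral (fun t => sph lam (hyp t)) R
      * ∫ t in (0 : ℝ)..R, Real.sinh (2 * t) * sph lam (hyp t)) := by
    filter_upwards [eventually_gt_atTop 0] with R hR0
    exact mul_nonneg (sphDecay_pos hlam hR0).le (mul_nonneg (tailIntegral_sph_nonneg hlam hR0)
      (integral_nonneg hR0.le (fun t ht => sinh_mul_sph_hyp_nonneg lam ht.1)))
  have hup : Tendsto (fun R => 4 * L * K * C₀ * Real.exp (-(3 * lam - 2) * R)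
      + 4 * L * K * cfun (2 - lam) * (R * Real.exp (-(2 * lam - 2) * R))) atTop (𝓝 0) := by
    have hA : Tendsto (fun R : ℝ => Real.exp (-(3 * lam - 2) * R)) atTop (𝓝 0) := by
      have := Real.tendsto_exp_atBot.comp (tendsto_id.const_mul_atTop_of_neg (by linarith : -(3 * lam - 2) < 0))
      simpa only [Function.comp_def, id] using this
    have hB := tendsto_mul_exp_neg_mul_atTop (by linarith : 0 < 2 * lam - 2)
    have := (hA.const_mul (4 * L * K * C₀)).add (hB.const_mul (4 * L * K * cfun (2 - lam)))
    simpa only [mul_zero, add_zero] using this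
  exact tendsto_of_tendsto_of_tendsto_of_le_of_le' tendsto_const_nhds hup hlower hbound

/-! ### The bracket -/

/-- **`sinh 2t χ_λ χ_λ′ = λ(λ−2) · χ_λ T_λ ∫_0^t sinh 2s φ_λ − T_λ`** on `(0, ∞)`. -/
theorem sinh_mul_sphDecay_mul_sphDecay' {lam : ℝ} (hlam : 1 < lam) {t : ℝ} (ht : 0 < t) :
    Real.sinh (2 * t) * (sphDecay lam t * sphDecay' lam t)
      = lam * (lam - 2) * (sphDecay lam t * (tailIntegral (fun t => sph lam (hyp t)) t
          * ∫ s in (0 : ℝ)..t, Real.sinh (2 * s) * sph lam (hyp s)))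
        - tailIntegral (fun t => sph lam (hyp t)) t := by
  rw [sphDecay'_eq hlam ht]
  have hφ : 0 < sph lam (hyp t) := sph_hyp_pos lam t
  have hs : 0 < Real.sinh (2 * t) := sinh_two_mul_pos ht
  have hdiv := sinh_mul_deriv_sph_hyp_eq lam t
  have hinv : Real.sinh (2 * t) * sph lam (hyp t) * (Real.sinh (2 * t) * sph lam (hyp t))⁻¹ = 1 :=
    mul_inv_cancel₀ (mul_pos hs hφ).ne'
  rw [sphDecay_eq]
  linear_combination (sph lam (hyp t) * tailIntegral (fun t => sph lam (hyp t)) t ^ 2) * hdiv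
    - tailIntegral (fun t => sph lam (hyp t)) t * hinv

/-- **The bracket `sinh 2R · χ_λ(R) χ_λ′(R) → 0`** as `R → ∞`, for every `λ > 1`. -/
theorem tendsto_sinh_mul_sphDecay_mul_sphDecay' {lam : ℝ} (hlam : 1 < lam) :
    Tendsto (fun R => Real.sinh (2 * R) * (sphDecay lam R * sphDecay' lam R)) atTop (𝓝 0) := by
  have h := ((tendsto_sphDecay_mul_tailIntegral_mul_integral hlam).const_mul (lam * (lam - 2))).sub
    (tendsto_tailIntegral_sph_atTop hlam)
  rw [mul_zero, sub_zero] at h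
  refine h.congr' ?_
  filter_upwards [eventually_gt_atTop 0] with R hR
  exact (sinh_mul_sphDecay_mul_sphDecay' hlam hR).symm

end measure

end Summit.Ventures.HodgeRepro2.T5SU11SphericalDecayBracket
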